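import Summits.QuantumFields.BalabanUV.T4Continuum.Support.VariationalVectorGaugeSliceB5
import Summits.QuantumFields.BalabanUV.T4Continuum.Support.VariationalVectorTower

/-!
# T⁴ programme, spine node NE2 (U1a), lane P2 — LEAF V-GF, file 4: THE VECTOR END's SOCKETS FOR BAŁABAN's GAUGE FUNCTIONAL AT `U = 1`, LEVEL BY LEVEL —
# the matrix binders `hGm`∕`hG` (`projG 1 (ker Q′_1) = qform(n⁻²·∂(I − P)∂ᴴ) ∘ unc`, PSD), the transport binders `hRtr`∕`hTcomp`∕`hGtr` (flat data compose to
# flat data; `hGtr` by PULLBACK along `sites`), leaf V-P at BOTH levels (`hPc`∕`hPf`, `C_P = (d+1)·Cst(d,1)`, k-uniform) and (SLICE) (`σ = σ′ = 0`) — model level, `E = ℂ`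

NE2 formalisation swarm `b2b-balaban-t4-ne2-formalise-*`, leaf prover 09 GEN 7 (`prover-b2b-balaban-t4-ne2-formalise-leaf-09-g7-0`); journal INTENT
CLAIMS.log 2026-08-20 «V-GF AT U = 1», file 4.  On top of files 1–3 of this leaf (`VariationalVectorGaugeSlice{,Flat,B5}`: `projG`, `kerAvgFlat`, `hslice_flat'`,
`form_gauge_unc`, `hPc_flat`∕`qWV_le_flat`) and, BY NAME, leaf-10-g3's `VariationalVectorTower.{Gtr, Gtr_transport, comp_symm_comp, qVV_eq_transport, SfV_eq_transport}`
(p218948), leaf-03-g4's `VectorLineComposite.{compL, QvL_comp}` (p218283), leaf-02-g4's `VariationalColourTower.Rtrv`, the owner's `VariationalVectorEffective.unc` and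
pv15's `B5Value126.{PcT, PcT_conjTranspose, one_sub_PcT_proj}`.  TARGET SHAPES: the binders of leaf-10-g3's `VariationalVectorEndOfLeaves(Slice).towerLimitRate_effV_of_leaves(_slice)`
(p220074 ∕ p221732) along `n_k = L^k` at FLAT data `R k = R′ k = 1`, `T k = T′ k = 1`.

THE STATEMENTS (model level; `E = ℂ`; flat data).
 * §1 `GmFlat n M := n⁻² • ∂·(I − PcT)·∂ᴴ` (pv15's typed `P`, `∂ = GradOp n`), **`GmFlat_posSemidef`** (`∂(I−P)∂ᴴ = (∂(I−P))(∂(I−P))ᴴ`), **`projG_flat_eq_qform`**: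
   `projG 1 (ker Q′_1) W = qform (GmFlat n M) (unc W)` (file 3's `form_gauge_unc`) — the END's `hGm`∕`hG`;
 * §2 `Rtrv_flat` (`rfl`), `compL_flat` (`compL 1 1 = 1`), **`Gtr_pullback`**: `Gtr n L M (W′ ↦ G (W′ ∘ sites)) = G` for ANY level-`n·L` functional `G` — so the END's
   `hGtr : G (k+1) = Gtr (G′ k)` is met by DEFINING `G′ k` as the pullback of `G (k+1)` (the binder constrains nothing beyond that choice);
 * §3 `projGf n L M := projG_{n·L} 1 (ker Q′) ∘ (· ∘ sites)`, `Gtr_projGf`, `QvL_comp_flat` (`Q_n ∘ Q_L = Q_{nL} ∘ sites*` at flat data), **`qVV_le_flat`** ∕ **`hPf_flat`**: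
   `qVV n L M W′ ≤ (d+1)·Cst(d,a)·(SfV n L M 1 projGf W′ + a·nsqV M (Q_n(Q_L W′)))` — leaf V-P at the FINE level = `hPc_flat` at level `n·L` transported;
 * §4 the tower data `Gk L M k := projG 1 (ker Q′_1)` on the `L^k`-torus, `Gk' L M k := projGf (L^k) L M`, `Gmk L M k := GmFlat (L^k) M`, and the END's sockets
   DISCHARGED level by level: `hGm_flat`, `hG_flat`, `hGtr_flat`, `hRtr_flat` (`rfl`), `hTcomp_flat`, **`hPc_tower`**, **`hPf_tower`** (`CP k = (d+1)·Cst(d,1)` for all `k`),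
   **`hslice_tower`** (`σ k = σ′ k = 0`).
WHAT REMAINS DISPLAYED in the slice END at flat data for this `G`: `hsurj₁`, V-UB (`hUBc`∕`hUBf`), the curl Federbush `hFEDcurl`, V-ONE (`hONE`, whose (SLICE′) input at
flat data is again file 2's slice one level up), V-REG (`hREG`, leaf-03-g5) and the decay∕uniformity constants — their flat-data inhabitants live in other lineages'
files (`VectorLineTransportFrame`, `VariationalVectorFederbushLinePhys`, `VariationalVectorOneStep{Flat,Slice}`); the ASSEMBLY of the `U = 1` END is the V-END holder's call.

HONEST FRAMING (T4-DAG p. 1).  Model level (`E = ℂ`, flat data); [folklore] bookkeeping over files 1–3 and kernel-certified Literature passes; nothing printed is a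
hypothesis; data `def`s `GmFlat`, `projGf`, `Gk`, `Gk'`, `Gmk` only, no `def … : Prop`, no `sorry`; axioms standard.  V-GF ∕ V-P with background OPEN; V-END ∕ NE2 NOT
proved; NE3 OPEN; spine PROVED 0∕9 unchanged; rung (B)+1 finite T⁴ — NOT infinite volume, NOT mass gap, NOT Clay.  HONEST DEPENDENCY (cell, verbatim): continuum YM
on T⁴ ⇐ BetaPertH ∧ nine spine estimates (0/9 proved); BetaPertH ⇐ (D1) ∧ (D4) ∧ CAP+tail; G-an2-4 gates asym, D1 and NE2/3/4.
-/

noncomputable section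

namespace Summit.QuantumFields.BalabanUV.T4Continuum.VariationalVectorGaugeSliceTower

open Finset WithLp Matrix
open scoped InnerProductSpace ComplexConjugate Matrix ComplexOrder
open Literature.MathematicalPhysics.QuantumFieldTheory.Balaban1983to89
open Literature.MathematicalPhysics.QuantumFieldTheory.Balaban1983to89.B5Prop11Plancherel (Tor fine unitVec Cst)
open Literature.MathematicalPhysics.QuantumFieldTheory.Balaban1983to89.B5Composition116 (sites)
open Literature.MathematicalPhysics.QuantumFieldTheory.Balaban1983to89.B5Action121 (GradOp)
open Literature.MathematicalPhysics.QuantumFieldTheory.Balaban1983to89.B5Value126 (PcT PcT_mul_PcT PcT_conjTranspose one_sub_PcT_proj)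
open Literature.Analysis.Complex (qform)
open Summit.QuantumFields.BalabanUV.T4Continuum.VariationalVectorForm (curlSq ScV SfV qWV qVV)
open Summit.QuantumFields.BalabanUV.T4Continuum.VectorBlockTrialForm (QvL nsqV compL QvL_comp)
open Summit.QuantumFields.BalabanUV.T4Continuum.VariationalColourTower (Rtrv)
open Summit.QuantumFields.BalabanUV.T4Continuum.VariationalVectorTower (Gtr Gtr_transport qVV_eq_transport SfV_eq_transport)
open Summit.QuantumFields.BalabanUV.T4Continuum.VariationalVectorEffective (unc)
open Summit.QuantumFields.BalabanUV.T4Continuum.VariationalVectorGaugeSlice (projG)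
open Summit.QuantumFields.BalabanUV.T4Continuum.VariationalVectorGaugeSliceFlat (kerAvgFlat)
open Summit.QuantumFields.BalabanUV.T4Continuum.VariationalVectorGaugeSliceB5 (flatR form_gauge_unc hPc_flat qWV_le_flat)

variable {d : ℕ} (n L : ℕ) [NeZero n] [NeZero L] (M : Fin d → ℕ) [hM : ∀ μ, NeZero (M μ)]

/-! ## §1 The END's matrix binders `hGm` ∕ `hG` for `projG` at flat data: `projG 1 (ker Q′_1) = qform (n⁻²·∂(I − P)∂ᴴ) ∘ unc`, PSD -/

section MatrixForm

/-- **the matrix of Bałaban's gauge functional at flat data**: `GmFlat n M := n⁻² • ∂·(I − P)·∂ᴴ` with pv15's typed `P = PcT n M n` and `∂ = GradOp n`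
([B5] (1.69)'s `∂R∂*` at unit lattice factor). [folklore] -/
def GmFlat : Matrix (Tor (fine n M) × Fin d) (Tor (fine n M) × Fin d) ℂ :=
  (((n : ℂ) ^ 2)⁻¹ : ℂ) • (GradOp (fine n M) (n : ℂ) * (1 - PcT n M (n : ℂ)) * (GradOp (fine n M) (n : ℂ))ᴴ)

/-- `∂(I − P)∂ᴴ = (∂(I − P))·(∂(I − P))ᴴ` (`I − P` a Hermitian idempotent), hence PSD; `n⁻² ≥ 0`. [folklore] -/
theorem GmFlat_posSemidef : (GmFlat n M).PosSemidef := by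
  have hn : (n : ℂ) ≠ 0 := by exact_mod_cast NeZero.ne n
  set R := (1 - PcT n M (n : ℂ)) with hR
  have hRH : Rᴴ = R := by rw [hR, Matrix.conjTranspose_sub, Matrix.conjTranspose_one, PcT_conjTranspose]
  have hRR : R * R = R := one_sub_PcT_proj n M (n : ℂ) hn
  have hfac : GradOp (fine n M) (n : ℂ) * R * (GradOp (fine n M) (n : ℂ))ᴴ
      = (GradOp (fine n M) (n : ℂ) * R) * (GradOp (fine n M) (n : ℂ) * R)ᴴ := by
    rw [Matrix.conjTranspose_mul, hRH, ← Matrix.mul_assoc (GradOp (fine n M) (n : ℂ) * R) R, Matrix.mul_assoc (GradOp (fine n M) (n : ℂ)) R R, hRR]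
  unfold GmFlat
  rw [hfac]
  refine (Matrix.posSemidef_self_mul_conjTranspose _).smul ?_
  have e : (((n : ℂ) ^ 2)⁻¹ : ℂ) = ((((n : ℝ) ^ 2)⁻¹ : ℝ) : ℂ) := by push_cast; rfl
  rw [e]
  exact Complex.zero_le_real.mpr (by positivity)

/-- **`hG` at flat data**: `projG 1 (ker Q′_1) W = qform (GmFlat n M) (unc W)`. [folklore] -/
theorem projG_flat_eq_qform (W : Tor (fine n M) → Fin d → ℂ) :
    projG (fine n M) (flatR n M) (kerAvgFlat n M) W = qform (GmFlat n M) (unc W) := by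
  have hn : (n : ℝ) ≠ 0 := by exact_mod_cast NeZero.ne n
  unfold qform GmFlat
  rw [Matrix.smul_mulVec, dotProduct_smul, form_gauge_unc, smul_eq_mul]
  have e : (((n : ℂ) ^ 2)⁻¹ : ℂ) = ((((n : ℝ) ^ 2)⁻¹ : ℝ) : ℂ) := by push_cast; rfl
  rw [e, ← Complex.ofReal_mul, Complex.ofReal_re]
  field_simp

end MatrixForm

/-! ## §2 The END's transport binders at flat data: `Rtrv 1 = 1`, `compL 1 1 = 1`, and `hGtr` by PULLBACK (any `G`) -/

section Transport

variable {E : Type*} [NormedAddCommGroup E] [NormedSpace ℂ E]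

omit [NeZero n] [NeZero L] hM in
/-- flat fine transports read on the `n·L`-torus are flat. [folklore] -/
theorem Rtrv_flat : Rtrv n L M (fun _ _ => (1 : E →L[ℂ] E)) = fun _ _ => 1 := rfl

omit [NeZero n] [NeZero L] hM in
/-- composite line transports of flat transports are flat: `compL 1 1 = 1`. [folklore] -/
theorem compL_flat : compL n L M (fun _ _ _ _ => (1 : E →L[ℂ] E)) (fun _ _ _ _ => (1 : E →L[ℂ] E)) = fun _ _ _ _ => 1 := by
  funext y Jx U μ
  simp only [compL, mul_one]

omit [NeZero n] [NeZero L] hM [NormedAddCommGroup E] [NormedSpace ℂ E] in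
/-- **`hGtr` BY PULLBACK**: for ANY level-`n·L` functional `G`, the one-step-coordinate functional `G′ := W′ ↦ G (W′ ∘ sites)` satisfies `Gtr G′ = G`
— the END's binder `G (k+1) = Gtr (G′ k)` is met by DEFINING `G′ k` as the pullback of `G (k+1)`. [folklore] -/
theorem Gtr_pullback (G : (Tor (fine (n * L) M) → Fin d → E) → ℝ) : Gtr n L M (fun W' => G (W' ∘ sites n L M)) = G := by
  funext W
  show G ((W ∘ (sites n L M).symm) ∘ sites n L M) = G W
  rw [VariationalVectorTower.comp_symm_comp]

end Transport

/-! ## §3 Leaf V-P at the FINE level (`hPf`) at flat data, from `hPc_flat` one level up -/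

section Fine

/-- the fine-level gauge functional at flat data in one-step coordinates: the PULLBACK along `sites` of `projG 1 (ker Q′_1)` at level `n·L`. [folklore] -/
def projGf (W' : Tor (fine L (fine n M)) → Fin d → ℂ) : ℝ :=
  projG (fine (n * L) M) (flatR (n * L) M) (kerAvgFlat (n * L) M) (W' ∘ sites n L M)

/-- `hGtr` for the pair (`projG` at level `n·L`, `projGf`). [folklore] -/
theorem Gtr_projGf : Gtr n L M (projGf n L M) = projG (fine (n * L) M) (flatR (n * L) M) (kerAvgFlat (n * L) M) :=
  Gtr_pullback n L M _

omit [NeZero n] [NeZero L] in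
/-- the composite of the flat averages is the flat average at level `n·L` (`QvL_comp` + `compL 1 1 = 1`). [folklore] -/
theorem QvL_comp_flat (W' : Tor (fine L (fine n M)) → Fin d → ℂ) :
    QvL n M (fun _ _ _ _ => (1 : ℂ →L[ℂ] ℂ)) (QvL L (fine n M) (fun _ _ _ _ => (1 : ℂ →L[ℂ] ℂ)) W')
      = QvL (n * L) M (fun _ _ _ _ => (1 : ℂ →L[ℂ] ℂ)) (W' ∘ sites n L M) := by
  rw [QvL_comp, compL_flat]
  rfl

/-- **LEAF V-P AT THE FINE LEVEL, FLAT DATA (`hPf`)**: `qVV n L M W′ ≤ (d+1)·Cst(d,a)·(SfV n L M 1 projGf W′ + a·nsqV M (Q_1(Q_1 W′)))` — `hPc_flat` at level `n·L`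
transported along `sites` (`qVV_eq_transport`, `SfV_eq_transport`, `QvL_comp`). [folklore] -/
theorem qVV_le_flat {a : ℝ} (ha : 0 < a) (W' : Tor (fine L (fine n M)) → Fin d → ℂ) :
    qVV n L M W' ≤ ((d + 1 : ℝ) * Cst d a) * (SfV n L M (flatR L (fine n M)) (projGf n L M) W'
          + a * nsqV M (QvL n M (fun _ _ _ _ => (1 : ℂ →L[ℂ] ℂ)) (QvL L (fine n M) (fun _ _ _ _ => (1 : ℂ →L[ℂ] ℂ)) W'))) := by
  rw [qVV_eq_transport, SfV_eq_transport, QvL_comp_flat, Gtr_projGf]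
  exact qWV_le_flat (n * L) M ha (W' ∘ sites n L M)

/-- the same at `a = 1` in the END's exact `hPf k` shape. [folklore] -/
theorem hPf_flat (W' : Tor (fine L (fine n M)) → Fin d → ℂ) :
    qVV n L M W' ≤ ((d + 1 : ℝ) * Cst d 1) * (SfV n L M (flatR L (fine n M)) (projGf n L M) W'
          + nsqV M (QvL n M (fun _ _ _ _ => (1 : ℂ →L[ℂ] ℂ)) (QvL L (fine n M) (fun _ _ _ _ => (1 : ℂ →L[ℂ] ℂ)) W'))) := by
  simpa using qVV_le_flat n L M one_pos W'

end Fine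

/-! ## §4 The U = 1 tower data for Bałaban's gauge functional: the END's structural and V-P∕(SLICE) sockets discharged level by level -/

section Tower

/-- the level-`k` gauge functional `G k := projG 1 (ker Q′_1)` on the `L^k`-fine torus. [folklore] -/
def Gk (k : ℕ) : (Tor (fine (L ^ k) M) → Fin d → ℂ) → ℝ := projG (fine (L ^ k) M) (flatR (L ^ k) M) (kerAvgFlat (L ^ k) M)

/-- its one-step-coordinate pullback `G′ k`. [folklore] -/
def Gk' (k : ℕ) : (Tor (fine L (fine (L ^ k) M)) → Fin d → ℂ) → ℝ := projGf (L ^ k) L M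

/-- its matrix `Gm k := GmFlat (L^k) M`. [folklore] -/
def Gmk (k : ℕ) : Matrix (Tor (fine (L ^ k) M) × Fin d) (Tor (fine (L ^ k) M) × Fin d) ℂ := GmFlat (L ^ k) M

/-- `hGm`: every `Gm k` is PSD. [folklore] -/
theorem hGm_flat (k : ℕ) : (Gmk L M k).PosSemidef := GmFlat_posSemidef (L ^ k) M

/-- `hG`: `G k W = qform (Gm k) (unc W)`. [folklore] -/
theorem hG_flat (k : ℕ) (W : Tor (fine (L ^ k) M) → Fin d → ℂ) : Gk L M k W = qform (Gmk L M k) (unc W) := projG_flat_eq_qform (L ^ k) M W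

/-- `hGtr`: `G (k+1) = Gtr (L^k) L M (G′ k)` (`L^(k+1) = L^k·L` by `rfl`). [folklore] -/
theorem hGtr_flat (k : ℕ) : Gk L M (k + 1) = Gtr (L ^ k) L M (Gk' L M k) := (Gtr_projGf (L ^ k) L M).symm

omit [NeZero L] hM in
/-- `hRtr`: flat transports one level up are the transported flat transports. [folklore] -/
theorem hRtr_flat (k : ℕ) : (flatR (L ^ (k + 1)) M) = Rtrv (L ^ k) L M (fun _ _ => (1 : ℂ →L[ℂ] ℂ)) := rfl

omit [NeZero L] hM in
/-- `hTcomp`: flat line transports compose to flat line transports. [folklore] -/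
theorem hTcomp_flat (k : ℕ) :
    (fun _ _ _ _ => (1 : ℂ →L[ℂ] ℂ) : Tor M → (Fin d → Fin (L ^ (k + 1))) → Fin (L ^ (k + 1)) → Fin d → (ℂ →L[ℂ] ℂ))
      = compL (L ^ k) L M (fun _ _ _ _ => (1 : ℂ →L[ℂ] ℂ)) (fun _ _ _ _ => (1 : ℂ →L[ℂ] ℂ)) := (compL_flat (L ^ k) L M).symm

/-- `hPc`: leaf V-P at every level, `C_P = (d+1)·Cst(d,1)`. [folklore] -/
theorem hPc_tower (k : ℕ) (W : Tor (fine (L ^ k) M) → Fin d → ℂ) :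
    qWV (L ^ k) M W ≤ ((d + 1 : ℝ) * Cst d 1) * (ScV (L ^ k) M (flatR (L ^ k) M) (Gk L M k) W + nsqV M (QvL (L ^ k) M (fun _ _ _ _ => (1 : ℂ →L[ℂ] ℂ)) W)) :=
  hPc_flat (L ^ k) M W

/-- `hPf`: leaf V-P at every fine level. [folklore] -/
theorem hPf_tower (k : ℕ) (W' : Tor (fine L (fine (L ^ k) M)) → Fin d → ℂ) :
    qVV (L ^ k) L M W' ≤ ((d + 1 : ℝ) * Cst d 1) * (SfV (L ^ k) L M (flatR L (fine (L ^ k) M)) (Gk' L M k) W'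
          + nsqV M (QvL (L ^ k) M (fun _ _ _ _ => (1 : ℂ →L[ℂ] ℂ)) (QvL L (fine (L ^ k) M) (fun _ _ _ _ => (1 : ℂ →L[ℂ] ℂ)) W'))) :=
  hPf_flat (L ^ k) L M W'

/-- `hslice` with `σ k = σ′ k = 0`: (SLICE) at every level (file 2). [folklore] -/
theorem hslice_tower (k : ℕ) (W : Tor (fine (L ^ k) M) → Fin d → ℂ) :
    ∃ Ws, QvL (L ^ k) M (fun _ _ _ _ => (1 : ℂ →L[ℂ] ℂ)) Ws = QvL (L ^ k) M (fun _ _ _ _ => (1 : ℂ →L[ℂ] ℂ)) W ∧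
      ScV (L ^ k) M (flatR (L ^ k) M) (Gk L M k) Ws ≤ ScV (L ^ k) M (flatR (L ^ k) M) (fun _ => 0) W
          + 0 * ScV (L ^ k) M (flatR (L ^ k) M) (fun _ => 0) W + 0 * qWV (L ^ k) M W :=
  VariationalVectorGaugeSliceFlat.hslice_flat' (L ^ k) M W

end Tower

end Summit.QuantumFields.BalabanUV.T4Continuum.VariationalVectorGaugeSliceTower

end
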